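import Mathlib
import Summits.Ventures.PercRepro2.Defs
import Summits.Ventures.PercRepro2.Independence
import Summits.Ventures.PercRepro2.Harris
import Summits.Ventures.PercRepro2.Graph
import Summits.Ventures.PercRepro2.Exploration
import Summits.Ventures.PercRepro2.Events
import Summits.Ventures.PercRepro2.FourFunctions
import Summits.Ventures.PercRepro2.Induced
import Summits.Ventures.PercRepro2.Frontier
import Summits.Ventures.PercRepro2.ObsIndependence
import Summits.Ventures.PercRepro2.BHK
import Summits.Ventures.PercRepro2.BHKEvents
import Summits.Ventures.PercRepro2.MultiSource
import Summits.Ventures.PercRepro2.OrderPreservation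
import Summits.Ventures.PercRepro2.SeedSet
import Summits.Ventures.PercRepro2.MultiSourceFun
import Summits.Ventures.PercRepro2.CrossRootT
import Summits.Ventures.PercRepro2.VdBKahn
import Summits.Ventures.PercRepro2.HullDefs
import Summits.Ventures.PercRepro2.CCTRootEdge
import Summits.Ventures.PercRepro2.CCTAvoidedEdge
import Summits.Ventures.PercRepro2.R1Rung
import Summits.Ventures.PercRepro2.CC2Rung
import Summits.Ventures.PercRepro2.PASubDefs
import Summits.Ventures.PercRepro2.HalfN
import Summits.Ventures.PercRepro2.CCTLin

/-!
# Row 2′CCT-LIN, the S-frame: objects and the row (L1-S) (blind cell PercRepro2, typer-1; mine-c g3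
MINE-C.md §10.3 "THE S-FRAME REDUCTION — the merge linearised"; lead g11 typer queue (3) "(L1-S)
typing (needs the merge class / π(S) / r_a(S) objects)")

Root `s`, avoided set `T`, targets `a, b`, an edge `e`; `ω⁺ = ω[e ↦ open]`, `ω⁻ = ω[e ↦ closed]`.
The S-frame conditions on `S = C_{ω⁻}(s)`, the `e`-CLOSED cluster of the root (`Sset`, event
`SEvent W = {S = W}`); with `X⁺ = {s ↔ a in ω⁺}` (`CCTLin.Xplus`) and `R⁺ = {s avoids T in ω⁺}`
(`PASub.Rplus`), mine-c's objects are

* `P(S)·P(a ∈ S⁺, R⁺ | S) = P(X⁺ ∩ R⁺ ∩ {S = W})`, `P(S)·P(R⁺ | S) = P(R⁺ ∩ {S = W})`, so the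
  **linearised joint mass** `Ã₁ = Σ_S P(S)·P(a ∈ S⁺, R⁺ | S)·P(b ∈ S⁺, R⁺ | S) / P(R⁺ | S)` is
  `linJoint = Σ_W P(X⁺ ∩ R⁺ ∩ {S = W}) · P(Y⁺ ∩ R⁺ ∩ {S = W}) / P(R⁺ ∩ {S = W})` (a vanishing
  denominator only occurs with vanishing numerators; Lean's `x / 0 = 0` gives the same value);
* **`L1S`** = (CC-T) with `Ã₁` in place of the joint `e`-open mass `A₁ = F₁ᵃᵇ`:
  `0 ≤ Ã₁ P₀² − P₀ (F₀ᵃ F₁ᵇ + F₁ᵃ F₀ᵇ) + F₀ᵃ F₀ᵇ P₁` (mine-c's four-term form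
  `Ã₁P₀² + F₀G₀P₁ ≥ P₀(F₁G₀ + F₀G₁)`), closure `L1S_all`.

This file also proves the structural facts of the frame used by the reduction (L1-S) ⟹ (CC-T)
(file `L1S.lean`, namespace `SFrame`): `{S = W}` depends only on the edges touching `W` (`dependsOn_SEvent`), the
partition `P(A) = Σ_W P(A ∩ {S = W})` (`prob_eq_sum_SEvent`), and the **merge identity**: for
`e = {u, w}` with `u ∈ W`, `w ∉ W`, on `{S = W}` the `e`-open cluster of `s` is
`W ∪ C_{G − W}(w)` (`cluster_update_true_eq_union_of_merge`), while for `e ⊆ W` or `e ∩ W = ∅`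
it is `W` itself (`cluster_update_true_eq_of_both`, `CCT.cluster_update_true_eq_of_not_touch`).
-/

namespace Summit.Ventures.PercRepro2

namespace SFrame

open PASub CCTLin TwoSetRung

open scoped Classical

variable {V : Type*} {E : Type*} [Fintype E] [DecidableEq E] [Fintype V] [DecidableEq V]
  {R : Type*} [Field R] [LinearOrder R] [IsStrictOrderedRing R]

/-! ## The frame -/

section Objects

variable (ends : E → Sym2 V) (e : E) (s : V)

/-- The `e`-closed cluster of the root, `S = C_{ω⁻}(s)`. -/
def Sset (ω : Config E) : Set V := cluster ends (Function.update ω e false) s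

/-- The event `{S = W}`. -/
def SEvent (W : Set V) : Set (Config E) := {ω | Sset ends e s ω = W}

omit [Fintype E] [Fintype V] [DecidableEq V] in
/-- Membership in `{S = W}`. -/
lemma mem_SEvent {W : Set V} {ω : Config E} :
    ω ∈ SEvent ends e s W ↔ cluster ends (Function.update ω e false) s = W := Iff.rfl

omit [Fintype E] [Fintype V] [DecidableEq V] in
/-- `s ∈ S`. -/
lemma mem_Sset_self (ω : Config E) : s ∈ Sset ends e s ω := mem_cluster_self _ _ _

omit [Fintype E] [Fintype V] [DecidableEq V] in
/-- `{S = W}` is empty unless `s ∈ W`. -/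
lemma SEvent_eq_empty_of_notMem {W : Set V} (hs : s ∉ W) : SEvent ends e s W = ∅ := by
  ext ω
  simp only [Set.mem_empty_iff_false, iff_false]
  intro h
  exact hs (h ▸ mem_Sset_self ends e s ω)

omit [Fintype E] [Fintype V] [DecidableEq V] in
/-- `{S = W}` depends only on the edges touching `W` (the state of `e` is irrelevant). -/
lemma dependsOn_SEvent (W : Set V) : DependsOn (· ∈ SEvent ends e s W) (touches ends W) := by
  intro ω ω' h
  have h' : ∀ e' ∈ touches ends W,
      Function.update ω e false e' = Function.update ω' e false e' := by
    intro e' he'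
    by_cases hee : e' = e
    · subst hee; simp
    · rw [Function.update_of_ne hee, Function.update_of_ne hee]; exact h e' he'
  exact propext ⟨fun hS => cluster_eq_of_eqOn_touches h' hS,
    fun hS => cluster_eq_of_eqOn_touches (fun e' he' => (h' e' he').symm) hS⟩

omit [Fintype E] [Fintype V] [DecidableEq V] in
/-- On `{S = W}`, `s` reaches every vertex of `W` with `e` open. -/
lemma conn_update_true_of_mem {ω : Config E} {W : Set V} (hS : Sset ends e s ω = W) {x : V}
    (hx : x ∈ W) : Conn ends (Function.update ω e true) s x := by
  subst hS
  exact conn_mono (CCT.update_false_le_update_true' ω e) hx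

omit [Fintype E] [Fintype V] [DecidableEq V] in
/-- On `{S = W}` with `t ∈ W ∩ T`, the `e`-open avoidance `R⁺` fails. -/
lemma Rplus_inter_SEvent_eq_empty {W : Set V} {T : Finset V} {t : V} (ht : t ∈ T)
    (htW : t ∈ W) : Rplus ends e s T ∩ SEvent ends e s W = ∅ := by
  ext ω
  simp only [Set.mem_empty_iff_false, iff_false, Set.mem_inter_iff, not_and]
  intro hR hS
  exact hR t ht (conn_update_true_of_mem ends e s hS htW)

end Objects

/-! ## The row -/

section Rows

variable (p : E → R) (ends : E → Sym2 V) (e : E) (s : V) (T : Finset V)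

/-- **The linearised joint mass** `Ã₁ = Σ_W P(X⁺ ∩ R⁺ ∩ {S = W}) · P(Y⁺ ∩ R⁺ ∩ {S = W}) / P(R⁺ ∩ {S = W})`
(mine-c §10.3: `Σ_S P(S)·P(a ∈ S⁺, R⁺ | S)·P(b ∈ S⁺, R⁺ | S) / P(R⁺ | S)`). -/
noncomputable def linJoint (a b : V) : R :=
  ∑ W : Set V,
    prob p (Xplus ends e s a ∩ Rplus ends e s T ∩ SEvent ends e s W) *
        prob p (Xplus ends e s b ∩ Rplus ends e s T ∩ SEvent ends e s W) /
      prob p (Rplus ends e s T ∩ SEvent ends e s W)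

/-- **(L1-S)** (mine-c §10.3), cleared by `P₀²`:
`0 ≤ Ã₁ P₀² − P₀ (F₀ᵃ F₁ᵇ + F₁ᵃ F₀ᵇ) + F₀ᵃ F₀ᵇ P₁` — (CC-T) with the linearised joint mass. -/
def L1S (a b : V) : Prop :=
  0 ≤ linJoint p ends e s T a b * massP (Function.update p e 0) ends s T ^ 2 -
      massP (Function.update p e 0) ends s T *
        (massF (Function.update p e 0) ends s {a} T * massF (Function.update p e 1) ends s {b} T +
          massF (Function.update p e 1) ends s {a} T * massF (Function.update p e 0) ends s {b} T) +
      massF (Function.update p e 0) ends s {a} T * massF (Function.update p e 0) ends s {b} T *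
        massP (Function.update p e 1) ends s T

end Rows

section Closure

variable (R : Type*) [Field R] [LinearOrder R] [IsStrictOrderedRing R]

/-- (L1-S) over all finite graphs, admissible weights, edges, roots, avoided sets and targets. -/
def L1S_all : Prop :=
  ∀ (V E : Type) [Fintype V] [DecidableEq V] [Fintype E] [DecidableEq E]
    (ends : E → Sym2 V) (p : E → R), IsProbVec p →
    ∀ (e : E) (s : V) (T : Finset V) (a b : V), s ∉ T → a ∉ T → b ∉ T → L1S p ends e s T a b

end Closure

/-! ## The partition by `S` -/

section Partition

variable (p : E → R) (ends : E → Sym2 V) (e : E) (s : V)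

omit [DecidableEq V] [LinearOrder R] [IsStrictOrderedRing R] in
/-- The partition of an event by the value of `S`. -/
lemma prob_eq_sum_SEvent (A : Set (Config E)) :
    prob p A = ∑ W : Set V, prob p (A ∩ SEvent ends e s W) := by
  unfold prob
  rw [Finset.sum_comm]
  refine Finset.sum_congr rfl fun ω _ => ?_
  rw [Finset.sum_eq_single (Sset ends e s ω)]
  · by_cases hA : ω ∈ A
    · rw [Set.indicator_of_mem hA, Set.indicator_of_mem
        (show ω ∈ A ∩ SEvent ends e s (Sset ends e s ω) from ⟨hA, rfl⟩)]
    · rw [Set.indicator_of_notMem hA, Set.indicator_of_notMem (fun h => hA h.1)]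
  · intro W _ hW
    rw [Set.indicator_of_notMem]
    intro h
    exact hW h.2.symm
  · intro h
    exact absurd (Finset.mem_univ _) h

end Partition

/-! ## The `e`-open cluster on `{S = W}` -/

section Merge

variable (ends : E → Sym2 V) {e : E} (s : V)

omit [Fintype E] [Fintype V] [DecidableEq V] in
/-- `G − W` is below `ω⁺`. -/
lemma delConfig_le_update_true (W : Set V) (ω : Config E) :
    delConfig ends W ω ≤ Function.update ω e true := by
  intro e'
  by_cases h : e' ∈ touches ends W
  · rw [delConfig_apply_of_mem h]; exact Bool.false_le _
  · rw [delConfig_apply_of_notMem h]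
    by_cases hee : e' = e
    · subst hee; simp
    · rw [Function.update_of_ne hee]

omit [Fintype E] [DecidableEq E] [Fintype V] [DecidableEq V] in
/-- The cluster of `w ∉ W` in `G − W` stays outside `W`. -/
lemma cluster_delConfig_subset_compl {W : Set V} {w : V} (hw : w ∉ W) (ω : Config E) :
    cluster ends (delConfig ends W ω) w ⊆ Wᶜ := by
  intro x hx
  refine mem_of_conn_of_closed (ends := ends) (ω := delConfig ends W ω) (S := Wᶜ) ?_ hw hx
  intro y hy z hyz
  obtain ⟨_, e', he', hends'⟩ := openGraph_adj.1 hyz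
  intro hz
  have ht : e' ∈ touches ends W := ⟨z, hz, y, by rw [hends', Sym2.eq_swap]⟩
  rw [delConfig_apply_of_mem ht] at he'
  exact Bool.false_ne_true he'

omit [Fintype E] [Fintype V] [DecidableEq V] in
/-- If both ends of `e` lie in the `e`-closed cluster of `s`, opening `e` leaves it unchanged. -/
lemma cluster_update_true_eq_of_both {u w : V} (hends : ends e = s(u, w)) (ω : Config E)
    (hu : u ∈ cluster ends (Function.update ω e false) s)
    (hw : w ∈ cluster ends (Function.update ω e false) s) :
    cluster ends (Function.update ω e true) s = cluster ends (Function.update ω e false) s := by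
  refine Set.Subset.antisymm ?_ (cluster_mono (CCT.update_false_le_update_true' ω e) s)
  intro x hx
  refine mem_of_conn_of_closed (ends := ends) (ω := Function.update ω e true)
    (S := cluster ends (Function.update ω e false) s) ?_ (mem_cluster_self _ _ _) hx
  intro y hy z hyz
  obtain ⟨_, e', he', hends'⟩ := openGraph_adj.1 hyz
  by_cases hee : e' = e
  · subst hee
    rw [hends, Sym2.eq_iff] at hends'
    rcases hends' with ⟨rfl, rfl⟩ | ⟨rfl, rfl⟩
    · exact hw
    · exact hu
  · rw [Function.update_of_ne hee] at he'
    have he'' : Function.update ω e false e' = true := by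
      rw [Function.update_of_ne hee]; exact he'
    exact Hull.mem_cluster_of_edge hy he'' hends'

omit [Fintype E] [Fintype V] [DecidableEq V] in
/-- **The merge identity**: for `e = {u, w}` with `u ∈ W = S`, `w ∉ W`, the `e`-open cluster of
`s` is `W ∪ C_{G − W}(w)`. -/
lemma cluster_update_true_eq_union_of_merge {u w : V} (hends : ends e = s(u, w)) (ω : Config E)
    {W : Set V} (hS : cluster ends (Function.update ω e false) s = W) (hu : u ∈ W) (hw : w ∉ W) :
    cluster ends (Function.update ω e true) s = W ∪ cluster ends (delConfig ends W ω) w := by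
  have hsu : Conn ends (Function.update ω e true) s u := conn_update_true_of_mem ends e s hS hu
  have huw : Conn ends (Function.update ω e true) u w :=
    conn_of_openAdj ⟨e, by simp, hends⟩
  have hCW := cluster_delConfig_subset_compl ends hw ω
  refine Set.Subset.antisymm ?_ ?_
  · intro x hx
    refine mem_of_conn_of_closed (ends := ends) (ω := Function.update ω e true)
      (S := W ∪ cluster ends (delConfig ends W ω) w) ?_ (Or.inl (hS ▸ mem_cluster_self _ _ _)) hx
    intro y hy z hyz
    obtain ⟨_, e', he', hends'⟩ := openGraph_adj.1 hyz
    by_cases hee : e' = e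
    · subst hee
      rw [hends, Sym2.eq_iff] at hends'
      rcases hends' with ⟨rfl, rfl⟩ | ⟨rfl, rfl⟩
      · exact Or.inr (mem_cluster_self _ _ _)
      · exact Or.inl hu
    · rw [Function.update_of_ne hee] at he'
      have he'' : Function.update ω e false e' = true := by
        rw [Function.update_of_ne hee]; exact he'
      rcases hy with hyW | hyC
      · -- `y ∈ W = C_{ω⁻}(s)`: the `ω⁻`-open edge keeps `z` in `W`
        rw [← hS] at hyW ⊢
        exact Or.inl (Hull.mem_cluster_of_edge hyW he'' hends')
      · -- `y ∈ C_{G−W}(w)`: `y, z ∉ W`, so the edge survives the deletion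
        have hyW : y ∉ W := hCW hyC
        have hzW : z ∉ W := by
          intro hzW
          rw [← hS] at hzW
          exact hyW (hS ▸ Hull.mem_cluster_of_edge hzW he'' (by rw [hends', Sym2.eq_swap]))
        have hnot : e' ∉ touches ends W := by
          rintro ⟨x', hx', y', hxy'⟩
          rw [hends', Sym2.eq_iff] at hxy'
          rcases hxy' with ⟨rfl, rfl⟩ | ⟨rfl, rfl⟩
          · exact hyW hx'
          · exact hzW hx'
        have hD : delConfig ends W ω e' = true := by
          rw [delConfig_apply_of_notMem hnot]; exact he'
        exact Or.inr (Hull.mem_cluster_of_edge hyC hD hends')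
  · rintro x (hxW | hxC)
    · exact conn_update_true_of_mem ends e s hS hxW
    · exact conn_trans (conn_trans hsu huw)
        (conn_mono (delConfig_le_update_true ends W ω) hxC)

omit [Fintype E] [Fintype V] [DecidableEq V] in
/-- On `{S = W}` in the merge class, `X⁺ = {a ∈ W} ∪ {a ∈ C_{G − W}(w)}`. -/
lemma mem_Xplus_iff_of_merge {u w : V} (hends : ends e = s(u, w)) {ω : Config E}
    {W : Set V} (hS : cluster ends (Function.update ω e false) s = W) (hu : u ∈ W) (hw : w ∉ W)
    (a : V) : ω ∈ Xplus ends e s a ↔ a ∈ W ∨ a ∈ cluster ends (delConfig ends W ω) w := by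
  show Conn ends (Function.update ω e true) s a ↔ _
  rw [← mem_cluster, cluster_update_true_eq_union_of_merge ends s hends ω hS hu hw]
  rfl

omit [Fintype E] [Fintype V] [DecidableEq V] in
/-- On `{S = W}` in the merge class with `W ∩ T = ∅`, `R⁺ = {C_{G − W}(w) ∩ T = ∅}`. -/
lemma mem_Rplus_iff_of_merge {u w : V} (hends : ends e = s(u, w)) {ω : Config E}
    {W : Set V} (hS : cluster ends (Function.update ω e false) s = W) (hu : u ∈ W) (hw : w ∉ W)
    {T : Finset V} (hT : ∀ t ∈ T, t ∉ W) :
    ω ∈ Rplus ends e s T ↔ ∀ t ∈ T, t ∉ cluster ends (delConfig ends W ω) w := by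
  simp only [Rplus, Set.mem_setOf_eq, avoidAll, ← mem_cluster,
    cluster_update_true_eq_union_of_merge ends s hends ω hS hu hw, Set.mem_union, not_or]
  constructor
  · intro h t ht; exact (h t ht).2
  · intro h t ht; exact ⟨hT t ht, h t ht⟩

omit [Fintype E] [Fintype V] [DecidableEq V] in
/-- On `{S = W}` with both ends of `e` in `W` or both outside, `X⁺ = {a ∈ W}`. -/
lemma mem_Xplus_iff_of_both {u w : V} (hends : ends e = s(u, w)) {ω : Config E}
    {W : Set V} (hS : cluster ends (Function.update ω e false) s = W) (huw : u ∈ W ↔ w ∈ W)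
    (a : V) : ω ∈ Xplus ends e s a ↔ a ∈ W := by
  show Conn ends (Function.update ω e true) s a ↔ _
  rw [← mem_cluster]
  by_cases hu : u ∈ W
  · rw [cluster_update_true_eq_of_both ends s hends ω (hS ▸ hu) (hS ▸ huw.1 hu), hS]
  · rw [CCT.cluster_update_true_eq_of_not_touch ends hends ω s (hS ▸ hu)
      (hS ▸ fun h => hu (huw.2 h)), hS]

omit [Fintype E] [Fintype V] [DecidableEq V] in
/-- On `{S = W}` with both ends of `e` in `W` or both outside, `R⁺ = {W ∩ T = ∅}`. -/
lemma mem_Rplus_iff_of_both {u w : V} (hends : ends e = s(u, w)) {ω : Config E}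
    {W : Set V} (hS : cluster ends (Function.update ω e false) s = W) (huw : u ∈ W ↔ w ∈ W)
    (T : Finset V) : ω ∈ Rplus ends e s T ↔ ∀ t ∈ T, t ∉ W := by
  simp only [Rplus, Set.mem_setOf_eq, avoidAll]
  constructor
  · intro h t ht htW
    exact h t ht ((mem_Xplus_iff_of_both ends s hends hS huw t).2 htW)
  · intro h t ht hc
    exact h t ht ((mem_Xplus_iff_of_both ends s hends hS huw t).1 hc)

end Merge

end SFrame

end Summit.Ventures.PercRepro2
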